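import Mathlib.AlgebraicGeometry.Noetherian
import Mathlib.Topology.Sober
import Mathlib.Topology.NoetherianSpace
import HarnessLib

/-!
# A maximal point of a closed set has an (affine) open neighbourhood on which the closed set lies in its closure —
# the topology half of U16 `GenericFibreModel` (GenericFibreSig §G0b; crux stmt-ResolutionOfSingularities-15315, chain w45a)

[OURS · L1 W4.5a · res-D-pv-019 AS res-L1-w45a-stub-7] Support file (`--supports stmt-ResolutionOfSingularities-15315 --as helper`)
for the crux `FrobeniusLadder.FInjectiveMacaulayfication`; NOT a statement of any manuscript; AI-written, weaker than expert review.

* `exists_isOpen_inter_subset_closure` — in a Noetherian quasi-sober space, if `C` is closed and no proper generization of `η`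
  lies in `C`, then some open `U ∋ η` has `C ∩ U ⊆ closure {η}`: write `C` as a finite union of irreducible closed sets
  (`NoetherianSpace.exists_finite_set_isClosed_irreducible`), discard those missing `η`; a member `t ∋ η` has a generic point
  `ξ ⤳ η` in `C`, so `ξ = η` and `t = closure {η}`.
* `exists_affineOpen_inter_subset_closure` — the same on a locally Noetherian scheme (work inside an affine open neighbourhood,
  a Noetherian quasi-sober subspace), with `U` AFFINE.
Used with `C` = the (closed) bad locus and `η` a bad point all of whose proper generizations are good: near `η` the bad locus is
`closure {η}`. Everything is PROVED; no definitions, no named facts.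
-/

-- single-problem summit: the doubled namespace component is forced
set_option linter.dupNamespace false

noncomputable section

open AlgebraicGeometry TopologicalSpace Topology

namespace Summit.ResolutionOfSingularities.ResolutionOfSingularities.Theorems.FInjectiveMacaulayfication.GenericFibreTopology

/-- **A point maximal in a closed set `C` (no proper generization in `C`) has an open neighbourhood `U` with
`C ∩ U ⊆ closure {η}`**, in a Noetherian quasi-sober space. [folklore] -/
theorem exists_isOpen_inter_subset_closure {X : Type*} [TopologicalSpace X] [NoetherianSpace X] [QuasiSober X]
    {C : Set X} (hC : IsClosed C) (η : X) (hgen : ∀ ξ : X, ξ ⤳ η → ξ ≠ η → ξ ∉ C) :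
    ∃ U : Set X, IsOpen U ∧ η ∈ U ∧ C ∩ U ⊆ closure {η} := by
  obtain ⟨S, hSf, hSc, hSi, hCS⟩ := NoetherianSpace.exists_finite_set_isClosed_irreducible hC
  refine ⟨(⋃ t ∈ {t ∈ S | η ∉ t}, t)ᶜ, ?_, ?_, ?_⟩
  · rw [isOpen_compl_iff]
    exact (hSf.subset (Set.sep_subset S _)).isClosed_biUnion fun t ht => hSc t ht.1
  · simp only [Set.mem_compl_iff, Set.mem_iUnion, Set.mem_setOf_eq, not_exists, and_imp]
    exact fun t _ hηt hη => hηt hη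
  · rintro x ⟨hxC, hxU⟩
    rw [hCS] at hxC
    obtain ⟨t, htS, hxt⟩ := Set.mem_sUnion.mp hxC
    have hηt : η ∈ t := by
      by_contra h
      exact hxU (Set.mem_biUnion (show t ∈ {t ∈ S | η ∉ t} from ⟨htS, h⟩) hxt)
    obtain ⟨ξ, hξ⟩ := QuasiSober.sober (hSi t htS) (hSc t htS)
    have hξC : ξ ∈ C := by
      rw [hCS]
      exact Set.mem_sUnion.mpr ⟨t, htS, hξ.mem⟩
    have hξη : ξ = η := by
      by_contra hne
      exact hgen ξ (hξ.specializes hηt) hne hξC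
    subst hξη
    rw [hξ.def]
    exact hxt

/-- **The same on a locally Noetherian scheme, with an AFFINE neighbourhood**: for `C ⊆ X` closed and `η ∈ X` with no proper
generization in `C`, there is an affine open `U ∋ η` with `C ∩ U ⊆ closure {η}` (work in an affine open neighbourhood of `η`, a
Noetherian quasi-sober subspace, then shrink to an affine open). [folklore] -/
theorem exists_affineOpen_inter_subset_closure (X : Scheme.{0}) [IsLocallyNoetherian X] {C : Set X} (hC : IsClosed C)
    (η : X) (hgen : ∀ ξ : X, ξ ⤳ η → ξ ≠ η → ξ ∉ C) :
    ∃ U : X.affineOpens, η ∈ (U : X.Opens) ∧ C ∩ (U : Set X) ⊆ closure {η} := by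
  -- an affine open neighbourhood `V` of `η`, a Noetherian quasi-sober subspace
  obtain ⟨V, hV, hηV, -⟩ := exists_isAffineOpen_mem_and_subset (X := X) (x := η) (U := ⊤) (Opens.mem_top η)
  haveI : IsNoetherianRing Γ(X, V) := IsLocallyNoetherian.component_noetherian ⟨V, hV⟩
  have hN : NoetherianSpace V := noetherianSpace_of_isAffineOpen V hV
  have hQ : QuasiSober V := V.2.isOpenEmbedding_subtypeVal.quasiSober
  -- the lemma in `V`
  have hCV : IsClosed ((Subtype.val : V → X) ⁻¹' C) := hC.preimage continuous_subtype_val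
  obtain ⟨U₀, hU₀, hηU₀, hsub⟩ := @exists_isOpen_inter_subset_closure V _ hN hQ _ hCV ⟨η, hηV⟩
    fun ξ hξη hne hξC => hgen ξ.1 (hξη.map continuous_subtype_val) (fun h => hne (Subtype.ext h)) hξC
  -- push the open set down to `X` and shrink to an affine open
  have hW : IsOpen (Subtype.val '' U₀ : Set X) := V.2.isOpenMap_subtype_val U₀ hU₀
  obtain ⟨U, hU, hηU, hUW⟩ := exists_isAffineOpen_mem_and_subset (X := X) (x := η) (U := ⟨_, hW⟩)
    (show η ∈ (Subtype.val '' U₀ : Set X) from ⟨⟨η, hηV⟩, hηU₀, rfl⟩)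
  refine ⟨⟨U, hU⟩, hηU, ?_⟩
  rintro x ⟨hxC, hxU⟩
  obtain ⟨v, hvU₀, rfl⟩ := hUW hxU
  have hv : v ∈ @closure _ instTopologicalSpaceSubtype ({⟨η, hηV⟩} : Set V) := hsub ⟨hxC, hvU₀⟩
  rw [closure_subtype] at hv
  refine closure_mono ?_ hv
  rintro _ ⟨w, hw, rfl⟩
  have hw' : w = ⟨η, hηV⟩ := hw
  subst hw'
  exact rfl

end Summit.ResolutionOfSingularities.ResolutionOfSingularities.Theorems.FInjectiveMacaulayfication.GenericFibreTopology

end
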